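import Summits.AtomisticToContinuum.Crystallization.Theorems.FrustratedLawDichotomyStrainedPatchHomEntryLeafHTA2QCellB385S2
import Summits.AtomisticToContinuum.Crystallization.Theorems.FrustratedLawDichotomyStrainedPatchHomEntryLeafHTA2QSq

/-!
# ★★★ THE `0.85 t_b` THREE-COARSE CELL END TO END WITH ONE INNER LEAF: `entryLeafOKHT4A2QQDCRS muRec qX90c pB385A2 QB385 GnB385 JT085 .leaf cT085 wB385 = true`
# (27623 `(H) HomFloor (1/625)`, hcp half; hand-1 g36; critic rows 1379 (ii) / 1389 (iii) «entry table k(t/t_b)»)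

decomp-a2c hand-1 g36 (crux `AperiodicFrustratedLawGap`, stmt-AtomisticToContinuum-27623).  KERNEL: ★ `treeA2QS_B385` — ONE inner hull leaf of the squared-test inner verdict
`…SqKit.entryLeafOKHQDCRS muRec qX90c` closes the sheet-tracked confined box `htWr pB385A2 = (1.992, 2.548, 0.931)e-3` (+ hull `(1.652, 1.404, 0.055)e-3`) of the `0.85 t_b`
three-coarse cell (seat probe K385d: one leaf / t2y / t4 all true); with `…CellB385S2.htCertSideA2Q_B385A2`: ★★★ `entryLeafOKHT4A2QQDCRS_B385A2` and ★ `okSE_B385`.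
ENTRY TABLE (hand-1 g36 FINDING §8): at `0.85 t_b` this is the largest admissible box measured (five-coarse and four-coarse fail the squared inner test at 1…8 leaves).

Kernel fact + assembly; 0 sorry; standard axioms; no definitions.  `--supports stmt-AtomisticToContinuum-27623`.
-/

namespace Summit.AtomisticToContinuum.Crystallization.Theorems.FrustratedLawDichotomyStrainedPatchHomEntryLeafHT

open Literature.Analysis.ValidatedNumerics.Numerics
open Summit.AtomisticToContinuum.Crystallization.Theorems.FrustratedLawDichotomyStrainedPatchHomCertTree (CertTree treeOK)
open Summit.AtomisticToContinuum.Crystallization.Theorems.FrustratedLawDichotomyStrainedPatchHomEntryTable (muRec)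
open Summit.AtomisticToContinuum.Crystallization.Theorems.FrustratedLawDichotomyStrainedPatchHomEntryFitTolerance (cT085)
open Summit.AtomisticToContinuum.Crystallization.Theorems.FrustratedLawDichotomyStrainedPatchHomEntryFitHcpCentred (entryLeafOKHQDCRS)
open Summit.AtomisticToContinuum.Crystallization.Theorems.FrustratedLawDichotomyStrainedPatchHomSlopeLJ
open Summit.AtomisticToContinuum.Crystallization.Theorems.FrustratedLawDichotomyStrainedPatchHomSlopeLJAffine
open Summit.AtomisticToContinuum.Crystallization.Theorems.FrustratedLawDichotomyStrainedPatchHomSlopeLJAffine2Kit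

set_option maxRecDepth 100000 in
set_option maxHeartbeats 4000000 in
/-- ★ KERNEL: ONE inner hull leaf of the squared-test inner verdict closes the second-order confined box of the `0.85 t_b` three-coarse cell. -/
theorem treeA2QS_B385 : treeOK (hullInner (entryLeafOKHQDCRS muRec qX90c) JT085 cT085) CertTree.leaf cT085 (htWr pB385A2 cT085 wB385) = true := by
  decide +kernel

/-- ★★★ **THE `0.85 t_b` THREE-COARSE CELL CLOSES END TO END THROUGH THE SECOND-ORDER AFFINE LEAF WITH THE SQUARED INNER TEST** (one inner leaf). [assembly] -/
theorem entryLeafOKHT4A2QQDCRS_B385A2 : entryLeafOKHT4A2QQDCRS muRec qX90c pB385A2 QB385 GnB385 JT085 CertTree.leaf cT085 wB385 = true := by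
  have h1 := htCertSideA2Q_B385A2
  have h2 := treeA2QS_B385
  unfold entryLeafOKHT4A2QQDCRS entryLeafOKHT4A2Q
  rw [h1, h2]
  rfl

/-- ★ … hence the `0.85 t_b` three-coarse cell is a one-leaf ∃-tree of the production verdict v2 `entryLeafOKHT4A2QQDCRSE muRec`. [formal bookkeeping] -/
theorem okSE_B385 : ∃ t : CertTree ((Fin 3 × Fin 3) ⊕ Fin 3), treeOK (entryLeafOKHT4A2QQDCRSE muRec) t cT085 wB385 = true :=
  exists_tree_HT4A2QQDCRSE_of_certS entryLeafOKHT4A2QQDCRS_B385A2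
end Summit.AtomisticToContinuum.Crystallization.Theorems.FrustratedLawDichotomyStrainedPatchHomEntryLeafHT
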